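import Summits.ResolutionOfSingularities.ResolutionOfSingularities.Theorems.FrobeniusLadderFInjectiveMacaulayficationCINondegenerateDefs
import Summits.ResolutionOfSingularities.ResolutionOfSingularities.Theorems.FrobeniusLadderFInjectiveMacaulayficationCensusBedsWeaklyNondegenerate
import Summits.ResolutionOfSingularities.ResolutionOfSingularities.Theorems.FrobeniusLadderFInjectiveMacaulayficationCIJacobian
import Mathlib.LinearAlgebra.LinearIndependent.Lemmas
import HarnessLib

/-!
# (A5a) DIAGONAL COMPLETE-INTERSECTION PAIRS `(Σ cᵢ xᵢ^{aᵢ}, Σ c′ᵢ xᵢ^{aᵢ})`: support, convenience, Khovanskii non-degeneracy, `x̄ᵥ ≠ 0`, regularity off the vertex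
# (crux `FInjectiveMacaulayfication` stmt-ResolutionOfSingularities-15315, chain w45a; res-L1-w45a-plan-1 RULING R23.3 (A5) «bed = the diagonal Brieskorn–Pham CI pair»;
# seat res-L1-w45a-stub-2 g12)

[OURS · L1 W4.5a] Support file (`--supports stmt-ResolutionOfSingularities-15315 --as helper`); def-free; UNCONDITIONAL; no named fact, no sorry; NOT a statement of
any manuscript; replaces the role of NO printed item. Nothing of the crux is proved. AI-written (AI review weaker than expert review).

The class hypotheses of ✓ `CIClassRowEqualSupport.fHalfRow_CI_of_convenient_equalSupport` for the family of DIAGONAL pairs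
`D = Σᵢ cᵢ·xᵢ^{aᵢ}`, `D′ = Σᵢ c′ᵢ·xᵢ^{aᵢ}` (`aᵢ ≥ 1`, all `cᵢ, c′ᵢ ≠ 0`), written `∑ i, monomial (single i (a i)) (c i)`:
* §1 coefficients / support (`= {aᵢ·eᵢ}` — so `D`, `D′` have EQUAL SUPPORTS and are CONVENIENT), `map`, partial derivatives;
* §2 ★ `ciNondegenerate_pair` — if the `2 × 2` minors `cᵢc′ⱼ − cⱼc′ᵢ` (`i ≠ j`) and the exponents `aᵢ` are non-zero in `K`, the pair is KHOVANSKII NON-DEGENERATE along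
  every positive weight (✓ `CINondegenerate.IsCINondegenerateAlong`): both initial forms along `w` are the face sums over the SAME face `Φ ⊆ {aᵢeᵢ}`; a lone vertex has no
  torus zero; two vertices `aᵢeᵢ ≠ aⱼeⱼ ∈ Φ` give the coordinates `i`, `j` of a vanishing combination `s·∇in D + t·∇in D′ = 0` as `(s cᵢ + t c′ᵢ)·aᵢqᵢ^{aᵢ−1} = 0`,
  `(s cⱼ + t c′ⱼ)·aⱼqⱼ^{aⱼ−1} = 0`, whence `s = t = 0`;
* §3 `mk_X_ne_zero_pair` — `x̄ᵥ ≠ 0` in `k[x]/(D, D′)` when all `aᵢ ≥ 2` (no generator has a term of degree `≤ 1`);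
* §4 ★ `isRegularLocalRing_off_vertex_pair` — `(k[x]/(D, D′))_Q` is regular at every prime `Q ⊉ (x̄)` when `(D, D′)` is prime: two variables `xᵢ, xⱼ ∉ Q` survive
  (one alone would give `cᵢxᵢ^{aᵢ} ∈ Q`), and the Jacobian minor `aᵢaⱼ(cᵢc′ⱼ − cⱼc′ᵢ)·xᵢ^{aᵢ−1}xⱼ^{aⱼ−1} ∉ Q` feeds ✓ `CIJacobian.ci_clause_of_det_not_mem`.
[cite: CuetoPopescupampuStepanov2023, Def. 4.2 (p. 12)] [cite: BoubakriGreuelMarkwig2010, §3 (p. 10)] [cite: Matsumura1987, Thm. 30.4 (ii)]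
-/

-- single-problem summit: the doubled namespace component is forced
set_option linter.dupNamespace false

noncomputable section

open MvPolynomial

namespace Summit.ResolutionOfSingularities.ResolutionOfSingularities.Theorems.FInjectiveMacaulayfication.DiagonalCIPair

open Summit.ResolutionOfSingularities.ResolutionOfSingularities.Theorems.FInjectiveMacaulayfication
open Literature.AlgebraicGeometry.Resolution Literature.AlgebraicGeometry.Resolution.BoubakriGreuelMarkwig CINondegenerate

variable {K : Type} [Field K] {n : ℕ}

/-! ## §1 Coefficients, support, convenience, base change, partial derivatives of a diagonal polynomial -/

/-- Coefficients of `Σ cᵢ xᵢ^{aᵢ}`. [plumbing] -/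
theorem coeff_diag (a : Fin n → ℕ) (c : Fin n → K) (α : Fin n →₀ ℕ) :
    coeff α (∑ i : Fin n, monomial (Finsupp.single i (a i)) (c i)) = ∑ i : Fin n, if Finsupp.single i (a i) = α then c i else 0 := by
  classical
  rw [coeff_sum]
  exact Finset.sum_congr rfl fun i _ => by rw [coeff_monomial]

/-- The coefficient of `xᵢ^{aᵢ}` is `cᵢ` (`aᵢ ≠ 0`). [plumbing] -/
theorem coeff_diag_single (a : Fin n → ℕ) (ha : ∀ i, a i ≠ 0) (c : Fin n → K) (i : Fin n) :
    coeff (Finsupp.single i (a i)) (∑ j : Fin n, monomial (Finsupp.single j (a j)) (c j)) = c i := by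
  classical
  rw [coeff_diag, Finset.sum_eq_single i (fun j _ hji => ?_) (fun h => (h (Finset.mem_univ i)).elim)]
  · rw [if_pos rfl]
  · rw [if_neg]
    intro h
    rcases Finsupp.single_eq_single_iff _ _ _ _ |>.mp h with ⟨hji', -⟩ | ⟨hj0, -⟩
    · exact hji hji'
    · exact ha j hj0

/-- A coefficient off the pure powers `aᵢeᵢ` vanishes. [plumbing] -/
theorem coeff_diag_eq_zero (a : Fin n → ℕ) (c : Fin n → K) (α : Fin n →₀ ℕ) (hα : ∀ i, Finsupp.single i (a i) ≠ α) :
    coeff α (∑ i : Fin n, monomial (Finsupp.single i (a i)) (c i)) = 0 := by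
  rw [coeff_diag]
  exact Finset.sum_eq_zero fun i _ => if_neg (hα i)

/-- The support of `Σ cᵢ xᵢ^{aᵢ}` lies in `{aᵢeᵢ}`. [plumbing] -/
theorem exists_eq_single_of_mem_support (a : Fin n → ℕ) (c : Fin n → K) (α : Fin n →₀ ℕ)
    (hα : α ∈ (∑ i : Fin n, monomial (Finsupp.single i (a i)) (c i)).support) : ∃ i, α = Finsupp.single i (a i) := by
  by_contra h
  push Not at h
  exact (MvPolynomial.mem_support_iff.mp hα) (coeff_diag_eq_zero a c α fun i hi => h i hi.symm)

/-- ★ The support of `Σ cᵢ xᵢ^{aᵢ}` IS `{aᵢeᵢ}` when all `cᵢ ≠ 0` (`aᵢ ≠ 0`). [plumbing] -/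
theorem mem_support_diag_iff (a : Fin n → ℕ) (ha : ∀ i, a i ≠ 0) (c : Fin n → K) (hc : ∀ i, c i ≠ 0) (α : Fin n →₀ ℕ) :
    α ∈ (∑ i : Fin n, monomial (Finsupp.single i (a i)) (c i)).support ↔ ∃ i, α = Finsupp.single i (a i) := by
  refine ⟨exists_eq_single_of_mem_support a c α, ?_⟩
  rintro ⟨i, rfl⟩
  rw [MvPolynomial.mem_support_iff, coeff_diag_single a ha c i]
  exact hc i

/-- ★ EQUAL SUPPORTS: `supp (Σ c′ᵢ xᵢ^{aᵢ}) = supp (Σ cᵢ xᵢ^{aᵢ})` (all `cᵢ, c′ᵢ ≠ 0`). [plumbing] -/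
theorem support_diag_eq (a : Fin n → ℕ) (ha : ∀ i, a i ≠ 0) (c c' : Fin n → K) (hc : ∀ i, c i ≠ 0) (hc' : ∀ i, c' i ≠ 0) :
    (∑ i : Fin n, monomial (Finsupp.single i (a i)) (c' i)).support = (∑ i : Fin n, monomial (Finsupp.single i (a i)) (c i)).support := by
  ext α
  rw [mem_support_diag_iff a ha c' hc', mem_support_diag_iff a ha c hc]

/-- ★ CONVENIENT: every variable occurs as a pure power with non-zero coefficient. [plumbing] -/
theorem convenient_diag (a : Fin n → ℕ) (ha : ∀ i, a i ≠ 0) (c : Fin n → K) (hc : ∀ i, c i ≠ 0) :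
    ∀ j : Fin n, ∃ N : ℕ, 0 < N ∧ coeff (Finsupp.single j N) (∑ i : Fin n, monomial (Finsupp.single i (a i)) (c i)) ≠ 0 :=
  fun j => ⟨a j, Nat.pos_of_ne_zero (ha j), by rw [coeff_diag_single a ha c j]; exact hc j⟩

/-- `Σ cᵢ xᵢ^{aᵢ} ≠ 0` (`n ≥ 1`, `cᵢ ≠ 0`). [plumbing] -/
theorem diag_ne_zero (hn : 0 < n) (a : Fin n → ℕ) (ha : ∀ i, a i ≠ 0) (c : Fin n → K) (hc : ∀ i, c i ≠ 0) :
    (∑ i : Fin n, monomial (Finsupp.single i (a i)) (c i)) ≠ 0 := fun h0 => by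
  have := coeff_diag_single a ha c ⟨0, hn⟩
  rw [h0, coeff_zero] at this
  exact hc _ this.symm

/-- Base change of a diagonal polynomial. [plumbing] -/
theorem map_diag {K' : Type} [CommRing K'] (φ : K →+* K') (a : Fin n → ℕ) (c : Fin n → K) :
    map φ (∑ i : Fin n, monomial (Finsupp.single i (a i)) (c i)) = ∑ i : Fin n, monomial (Finsupp.single i (a i)) (φ (c i)) := by
  rw [map_sum]
  exact Finset.sum_congr rfl fun i _ => by rw [map_monomial]

/-- `∂ⱼ (Σ cᵢ xᵢ^{aᵢ}) = cⱼaⱼ·xⱼ^{aⱼ−1}`. [folklore] -/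
theorem pderiv_diag (a : Fin n → ℕ) (c : Fin n → K) (j : Fin n) :
    pderiv j (∑ i : Fin n, monomial (Finsupp.single i (a i)) (c i)) = monomial (Finsupp.single j (a j - 1)) (c j * a j) := by
  classical
  rw [map_sum, Finset.sum_eq_single j (fun i _ hij => by
      rw [pderiv_monomial, Finsupp.single_apply, if_neg hij, Nat.cast_zero, mul_zero, monomial_zero])
    (fun h => (h (Finset.mem_univ j)).elim), pderiv_monomial, Finsupp.single_apply, if_pos rfl, Finsupp.single_tsub]

/-- `∂ⱼ` of the FACE SUM `Σ_{α ∈ Φ} (coeff α D)·x^α` of a diagonal `D` over a set of pure powers `Φ ∋ aⱼeⱼ`: only the vertex `aⱼeⱼ` survives. [folklore] -/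
theorem eval_pderiv_faceSum (a : Fin n → ℕ) (c : Fin n → K) (Φ : Finset (Fin n →₀ ℕ)) (hΦ : ∀ β ∈ Φ, ∃ i, β = Finsupp.single i (a i))
    (j : Fin n) (hj : Finsupp.single j (a j) ∈ Φ) (ha : ∀ i, a i ≠ 0) (q : Fin n → K) :
    MvPolynomial.eval q (pderiv j (∑ α ∈ Φ, monomial α (coeff α (∑ i : Fin n, monomial (Finsupp.single i (a i)) (c i))))) =
      c j * ((a j : K) * q j ^ (a j - 1)) := by
  classical
  rw [map_sum, map_sum, Finset.sum_eq_single (Finsupp.single j (a j)) (fun β hβ hβj => ?_) (fun h => (h hj).elim), pderiv_monomial,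
    coeff_diag_single a ha c j, Finsupp.single_apply, if_pos rfl, ← Finsupp.single_tsub, eval_monomial]
  · rw [Finsupp.prod_single_index (h := fun i e => q i ^ e) (pow_zero (q j)), mul_assoc]
  · obtain ⟨i, rfl⟩ := hΦ β hβ
    have hij : i ≠ j := fun h => hβj (h ▸ rfl)
    rw [pderiv_monomial, Finsupp.single_apply, if_neg hij, Nat.cast_zero, mul_zero, monomial_zero, map_zero]

/-! ## §2 ★ Khovanskii non-degeneracy of a diagonal pair along every positive weight -/

/-- ★ **A DIAGONAL PAIR `(Σ cᵢxᵢ^{aᵢ}, Σ c′ᵢxᵢ^{aᵢ})` IS KHOVANSKII NON-DEGENERATE ALONG EVERY POSITIVE WEIGHT** when the exponents `aᵢ` and the `2 × 2` minors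
`cᵢc′ⱼ − cⱼc′ᵢ` (`i ≠ j`) are non-zero in `K` (all `cᵢ, c′ᵢ ≠ 0`, `n ≥ 1`). See the module docstring, §2. [OURS · elementary certificate; cite:
CuetoPopescupampuStepanov2023, Def. 4.2 (p. 12); BoubakriGreuelMarkwig2010, §3 (p. 10)] -/
theorem ciNondegenerate_pair (hn : 0 < n) (a : Fin n → ℕ) (ha : ∀ i, a i ≠ 0) (haK : ∀ i, ((a i : ℕ) : K) ≠ 0)
    (c c' : Fin n → K) (hc : ∀ i, c i ≠ 0) (hc' : ∀ i, c' i ≠ 0) (hminor : ∀ i j, i ≠ j → c i * c' j ≠ c j * c' i)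
    (F : Fin 2 → MvPolynomial (Fin n) K) (hF0 : F 0 = ∑ i : Fin n, monomial (Finsupp.single i (a i)) (c i))
    (hF1 : F 1 = ∑ i : Fin n, monomial (Finsupp.single i (a i)) (c' i)) :
    ∀ w : Fin n → ℝ, (∀ i, 0 < w i) → IsCINondegenerateAlong w (fun l => (F l : MvPowerSeries (Fin n) K)) := by
  classical
  intro w _ q hq hzero
  -- the COMMON face `Φ` of `w` (equal supports)
  obtain ⟨Φ, hΦ⟩ : ∃ Φ : Finset (Fin n →₀ ℕ), Φ = (∑ i : Fin n, monomial (Finsupp.single i (a i)) (c i)).support.filter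
      (fun α => ∀ β ∈ (∑ i : Fin n, monomial (Finsupp.single i (a i)) (c i)).support, wdeg w α ≤ wdeg w β) := ⟨_, rfl⟩
  have hsupp : ∀ l, (F l).support = (∑ i : Fin n, monomial (Finsupp.single i (a i)) (c i)).support :=
    Fin.forall_fin_two.mpr ⟨by rw [hF0], by rw [hF1, support_diag_eq a ha c c' hc hc']⟩
  have hin : ∀ l, initialForm w (F l : MvPowerSeries (Fin n) K) =
      ((∑ α ∈ Φ, monomial α (coeff α (F l)) : MvPolynomial (Fin n) K) : MvPowerSeries (Fin n) K) := by
    intro l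
    rw [NewtonChartLemma.initialForm_coe_real (F l) w, hsupp l, hΦ]
  have hz : ∀ l, MvPolynomial.eval q (∑ α ∈ Φ, monomial α (coeff α (F l))) = 0 := fun l => by
    have h := hzero l
    rwa [hin l, NewtonChartLemma.evalAt_coe] at h
  have hfam : (fun l : Fin 2 => fun i : Fin n => evalAt (MvPowerSeries.pderiv i (initialForm w (F l : MvPowerSeries (Fin n) K))) q) =
      ![fun i => MvPolynomial.eval q (pderiv i (∑ α ∈ Φ, monomial α (coeff α (F 0)))),
        fun i => MvPolynomial.eval q (pderiv i (∑ α ∈ Φ, monomial α (coeff α (F 1))))] := by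
    funext l i
    rw [hin l, NewtonChartLemma.pderiv_coe, NewtonChartLemma.evalAt_coe]
    fin_cases l <;> rfl
  rw [hfam, LinearIndependent.pair_iff]
  intro s t hst
  have hΦsub : ∀ β ∈ Φ, ∃ i, β = Finsupp.single i (a i) := fun β hβ => by
    rw [hΦ, Finset.mem_filter] at hβ
    exact exists_eq_single_of_mem_support a c β hβ.1
  obtain ⟨α₁, hα₁, hmin⟩ := Finset.exists_min_image (∑ i : Fin n, monomial (Finsupp.single i (a i)) (c i)).support (fun α => wdeg w α)
    (MvPolynomial.support_nonempty.mpr (diag_ne_zero hn a ha c hc))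
  have hα₁Φ : α₁ ∈ Φ := by
    rw [hΦ, Finset.mem_filter]
    exact ⟨hα₁, hmin⟩
  -- a lone vertex has no torus zero, so the face carries two distinct vertices `aᵢeᵢ`, `aⱼeⱼ`
  have htwo : ∃ β ∈ Φ, β ≠ α₁ := by
    by_contra h
    push Not at h
    have hΦeq : Φ = {α₁} := Finset.eq_singleton_iff_unique_mem.mpr ⟨hα₁Φ, h⟩
    have h0 := hz 0
    rw [hΦeq, Finset.sum_singleton, hF0] at h0
    obtain ⟨i, rfl⟩ := hΦsub α₁ hα₁Φ
    rw [coeff_diag_single a ha c i] at h0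
    exact CensusBedsWeaklyNondegenerate.eval_monomial_ne_zero q hq _ _ (hc i) h0
  obtain ⟨β, hβΦ, hβα⟩ := htwo
  obtain ⟨i, rfl⟩ := hΦsub α₁ hα₁Φ
  obtain ⟨j, rfl⟩ := hΦsub β hβΦ
  have hij : i ≠ j := fun h => hβα (h ▸ rfl)
  -- the coordinates `m ∈ {i, j}` of `s•∇in D + t•∇in D′ = 0` read `(s c_m + t c′_m)·a_m q_m^{a_m − 1} = 0`
  have hcoord : ∀ m : Fin n, Finsupp.single m (a m) ∈ Φ → s * c m + t * c' m = 0 := by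
    intro m hm
    have h := congr_fun hst m
    simp only [Pi.add_apply, Pi.smul_apply, smul_eq_mul, Pi.zero_apply] at h
    rw [hF0, hF1, eval_pderiv_faceSum a c Φ hΦsub m hm ha q, eval_pderiv_faceSum a c' Φ hΦsub m hm ha q] at h
    have hM : (a m : K) * q m ^ (a m - 1) ≠ 0 := mul_ne_zero (haK m) (pow_ne_zero _ (hq m))
    have h' : (s * c m + t * c' m) * ((a m : K) * q m ^ (a m - 1)) = 0 := by rw [← h]; ring
    exact (mul_eq_zero.mp h').resolve_right hM
  have hi := hcoord i hα₁Φ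
  have hj := hcoord j hβΦ
  have ht : t * (c i * c' j - c j * c' i) = 0 := by linear_combination c i * hj - c j * hi
  have ht0 : t = 0 := (mul_eq_zero.mp ht).resolve_right (sub_ne_zero.mpr (hminor i j hij))
  rw [ht0, zero_mul, add_zero] at hi
  exact ⟨(mul_eq_zero.mp hi).resolve_right (hc i), ht0⟩

/-! ## §3 No variable vanishes on `V(D, D′)` -/

/-- The coefficient of `e_v` in `G · Σ cᵢxᵢ^{aᵢ}` vanishes when all `aᵢ ≥ 2`. [plumbing] -/
theorem coeff_single_one_mul_diag (a : Fin n → ℕ) (ha2 : ∀ i, 2 ≤ a i) (c : Fin n → K) (G : MvPolynomial (Fin n) K) (v : Fin n) :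
    coeff (Finsupp.single v 1) (G * ∑ i : Fin n, monomial (Finsupp.single i (a i)) (c i)) = 0 := by
  classical
  rw [coeff_mul]
  refine Finset.sum_eq_zero fun x hx => ?_
  rw [Finset.HasAntidiagonal.mem_antidiagonal] at hx
  by_cases hz : ∀ i, Finsupp.single i (a i) ≠ x.2
  · rw [coeff_diag_eq_zero a c x.2 hz, mul_zero]
  · push Not at hz
    obtain ⟨i, hi⟩ := hz
    exfalso
    have h1 := congrArg (fun α : Fin n →₀ ℕ => α i) hx
    simp only [Finsupp.add_apply, ← hi, Finsupp.single_apply] at h1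
    have h2 := ha2 i
    split_ifs at h1 <;> omega

/-- ★ **`x̄ᵥ ≠ 0` in `k[x]/(D, D′)`** for a diagonal pair with all exponents `aᵢ ≥ 2`: no combination `g₀D + g₁D′` has an `x_v`-term. [folklore] -/
theorem mk_X_ne_zero_pair (a : Fin n → ℕ) (ha2 : ∀ i, 2 ≤ a i) (c c' : Fin n → K) (F : Fin 2 → MvPolynomial (Fin n) K)
    (hF0 : F 0 = ∑ i : Fin n, monomial (Finsupp.single i (a i)) (c i)) (hF1 : F 1 = ∑ i : Fin n, monomial (Finsupp.single i (a i)) (c' i))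
    (v : Fin n) : Ideal.Quotient.mk (Ideal.span (Set.range F)) (X v) ≠ 0 := by
  classical
  intro h0
  rw [Ideal.Quotient.eq_zero_iff_mem, Ideal.mem_span_range_iff_exists_fun] at h0
  obtain ⟨g, hg⟩ := h0
  have h := congrArg (coeff (Finsupp.single v 1)) hg
  rw [coeff_sum, Fin.sum_univ_two, hF0, hF1, coeff_single_one_mul_diag a ha2 c (g 0) v, coeff_single_one_mul_diag a ha2 c' (g 1) v, add_zero,
    coeff_X] at h
  simp at h

/-! ## §4 ★ Regularity off the vertex -/

/-- If all variables but `xᵢ` lie in a prime `Q ⊇ (D, D′)`/`(D, D′)`, then so does `xᵢ` (`cᵢxᵢ^{aᵢ} = −Σ_{j≠i} cⱼxⱼ^{aⱼ}`, `cᵢ ≠ 0`, `aⱼ ≥ 1`). [folklore] -/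
theorem mk_X_mem_of_forall_ne (a : Fin n → ℕ) (ha : ∀ i, a i ≠ 0) (c : Fin n → K) (hc : ∀ i, c i ≠ 0) (F : Fin 2 → MvPolynomial (Fin n) K)
    (hF0 : F 0 = ∑ i : Fin n, monomial (Finsupp.single i (a i)) (c i))
    (Q : Ideal (MvPolynomial (Fin n) K ⧸ Ideal.span (Set.range F))) [Q.IsPrime] (i : Fin n)
    (h : ∀ j, j ≠ i → Ideal.Quotient.mk (Ideal.span (Set.range F)) (X j) ∈ Q) : Ideal.Quotient.mk (Ideal.span (Set.range F)) (X i) ∈ Q := by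
  classical
  have hD : Ideal.Quotient.mk (Ideal.span (Set.range F)) (F 0) = 0 := Ideal.Quotient.eq_zero_iff_mem.mpr (Ideal.subset_span ⟨0, rfl⟩)
  rw [hF0, map_sum, ← Finset.add_sum_erase _ _ (Finset.mem_univ i)] at hD
  have hrest : ∑ j ∈ Finset.univ.erase i, Ideal.Quotient.mk (Ideal.span (Set.range F)) (monomial (Finsupp.single j (a j)) (c j)) ∈ Q := by
    refine Ideal.sum_mem _ fun j hj => ?_
    have hji : j ≠ i := (Finset.mem_erase.mp hj).1
    rw [← C_mul_X_pow_eq_monomial, map_mul, map_pow]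
    exact Q.mul_mem_left _ (Q.pow_mem_of_mem (h j hji) _ (Nat.pos_of_ne_zero (ha j)))
  have hi : Ideal.Quotient.mk (Ideal.span (Set.range F)) (monomial (Finsupp.single i (a i)) (c i)) ∈ Q := by
    rw [(eq_neg_of_add_eq_zero_left hD)]
    exact Q.neg_mem hrest
  rw [← C_mul_X_pow_eq_monomial, map_mul, map_pow,
    Ideal.unit_mul_mem_iff_mem Q (((isUnit_iff_ne_zero.mpr (hc i)).map C).map (Ideal.Quotient.mk (Ideal.span (Set.range F))))] at hi
  exact ‹Q.IsPrime›.mem_of_pow_mem _ hi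

/-- The `2 × 2` Jacobian minor of a diagonal pair on the columns `(i, j)`: `aᵢaⱼ(cᵢc′ⱼ − cⱼc′ᵢ)·xᵢ^{aᵢ−1}xⱼ^{aⱼ−1}`. [folklore] -/
theorem det_pair (a : Fin n → ℕ) (c c' : Fin n → K) (F : Fin 2 → MvPolynomial (Fin n) K)
    (hF0 : F 0 = ∑ i : Fin n, monomial (Finsupp.single i (a i)) (c i)) (hF1 : F 1 = ∑ i : Fin n, monomial (Finsupp.single i (a i)) (c' i))
    (i j : Fin n) :
    (Matrix.of fun μ l => (![(pderiv i).restrictScalars ℤ, (pderiv j).restrictScalars ℤ] :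
        Fin 2 → Derivation ℤ (MvPolynomial (Fin n) K) (MvPolynomial (Fin n) K)) μ (F l)).det =
      C (((a i : ℕ) : K) * (a j : ℕ) * (c i * c' j - c j * c' i)) * (X i ^ (a i - 1) * X j ^ (a j - 1)) := by
  rw [Matrix.det_fin_two]
  simp only [Matrix.of_apply, Matrix.cons_val_zero, Matrix.cons_val_one, Derivation.restrictScalars_apply, hF0, hF1, pderiv_diag]
  simp only [← C_mul_X_pow_eq_monomial, map_mul, map_sub]
  ring

/-- ★ **`(k[x]/(D, D′))_Q` IS REGULAR AT EVERY PRIME `Q ⊉ (x̄)`** for a diagonal pair generating a PRIME ideal, with `aᵢ` and the minors `cᵢc′ⱼ − cⱼc′ᵢ` non-zero in `k`,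
all `cᵢ ≠ 0`: two variables `xᵢ, xⱼ ∉ Q` survive (`mk_X_mem_of_forall_ne`), the Jacobian minor `aᵢaⱼ(cᵢc′ⱼ − cⱼc′ᵢ)·xᵢ^{aᵢ−1}xⱼ^{aⱼ−1} ∉ Q`, and
✓ `CIJacobian.ci_clause_of_det_not_mem` concludes. [OURS · elementary certificate; cite: Matsumura1987, Thm. 30.4 (ii) and Thm. 14.2] -/
theorem isRegularLocalRing_off_vertex_pair (p : ℕ) [Fact p.Prime] {k : Type} [Field k] [CharP k p] (a : Fin n → ℕ) (ha : ∀ i, a i ≠ 0)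
    (hak : ∀ i, ((a i : ℕ) : k) ≠ 0) (c c' : Fin n → k) (hc : ∀ i, c i ≠ 0) (hminor : ∀ i j, i ≠ j → c i * c' j ≠ c j * c' i)
    (F : Fin 2 → MvPolynomial (Fin n) k)
    (hF0 : F 0 = ∑ i : Fin n, monomial (Finsupp.single i (a i)) (c i)) (hF1 : F 1 = ∑ i : Fin n, monomial (Finsupp.single i (a i)) (c' i))
    (Q : Ideal (MvPolynomial (Fin n) k ⧸ Ideal.span (Set.range F))) [Q.IsPrime]
    (hQ : ¬ Ideal.span (Set.range fun j : Fin n => Ideal.Quotient.mk (Ideal.span (Set.range F)) (X j)) ≤ Q) :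
    IsRegularLocalRing (Localization.AtPrime Q) := by
  classical
  -- two variables off `Q`
  have hex : ∃ i, Ideal.Quotient.mk (Ideal.span (Set.range F)) (X i) ∉ Q := by
    by_contra h
    push Not at h
    exact hQ (Ideal.span_le.mpr (by rintro _ ⟨j, rfl⟩; exact h j))
  obtain ⟨i, hi⟩ := hex
  have hex2 : ∃ j, j ≠ i ∧ Ideal.Quotient.mk (Ideal.span (Set.range F)) (X j) ∉ Q := by
    by_contra h
    push Not at h
    exact hi (mk_X_mem_of_forall_ne a ha c hc F hF0 Q i h)
  obtain ⟨j, hji, hj⟩ := hex2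
  -- the Jacobian minor on the columns `(i, j)` is off `Q`
  have hκ : ((a i : ℕ) : k) * (a j : ℕ) * (c i * c' j - c j * c' i) ≠ 0 :=
    mul_ne_zero (mul_ne_zero (hak i) (hak j)) (sub_ne_zero.mpr (hminor i j (Ne.symm hji)))
  have hndet : (Matrix.of fun μ l => (![(pderiv i).restrictScalars ℤ, (pderiv j).restrictScalars ℤ] :
      Fin 2 → Derivation ℤ (MvPolynomial (Fin n) k) (MvPolynomial (Fin n) k)) μ (F l)).det ∉
        Q.comap (Ideal.Quotient.mk (Ideal.span (Set.range F))) := by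
    rw [Ideal.mem_comap, det_pair a c c' F hF0 hF1 i j, map_mul,
      Ideal.unit_mul_mem_iff_mem Q (((isUnit_iff_ne_zero.mpr hκ).map C).map (Ideal.Quotient.mk (Ideal.span (Set.range F)))), map_mul, map_pow, map_pow]
    intro hmem
    rcases ‹Q.IsPrime›.mem_or_mem hmem with h1 | h2
    · exact hi (‹Q.IsPrime›.mem_of_pow_mem _ h1)
    · exact hj (‹Q.IsPrime›.mem_of_pow_mem _ h2)
  exact (CIJacobian.ci_clause_of_det_not_mem p k n 2 F Q _ hndet).1

end Summit.ResolutionOfSingularities.ResolutionOfSingularities.Theorems.FInjectiveMacaulayfication.DiagonalCIPair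

end
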